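import Summits.AtomisticToContinuum.Crystallization.Theorems.ChargedEnergyGapStressFreeFccD
import HarnessLib

/-!
# «StressFreeFcc» P-J FCC-W (lens-3 g61) — part 5 of 5 (sequel of `…ChargedEnergyGapStressFreeFccD`)

Split for the 400-line cap by the landing lane (hand-2 g31); the module docstring of part 1 (`…ChargedEnergyGapStressFreeFccA`) describes the whole node.  Same namespace; all FQNs unchanged.
0 sorry; standard axioms.
-/

noncomputable section
open scoped Classical
open Literature.MathematicalPhysics.StatisticalMechanics
open Literature.Geometry.DiscreteGeometry
open Summit.AtomisticToContinuum.Crystallization.Theses.PricedLinkCensus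
open Summit.AtomisticToContinuum.Crystallization.Theorems.ChargedEnergyGapNegative

namespace Summit.AtomisticToContinuum.Crystallization.Theorems.ChargedEnergyGapChartDial

-- PRIVATE copies (landing lane): these helpers are `private` in `ChargedEnergyGapStressFreeFccB` (dedup gate), so each consumer module carries its own private copy.
/-- `sqrt2_sq` (docstring added by the landing lane; see the module docstring). [formal bookkeeping] -/
private theorem sqrt2_sq : Real.sqrt 2 ^ 2 = 2 := Real.sq_sqrt (by norm_num)

/-- `sqrt2_pos` (docstring added by the landing lane; see the module docstring). [formal bookkeeping] -/
private theorem sqrt2_pos : 0 < Real.sqrt 2 := Real.sqrt_pos.2 (by norm_num)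

namespace Fcc

/-! ## Numerical window for the stress-free spacing: `3/5 ≤ a0·√2 ≤ 1`

Elementary certified bounds: `8·A ≤ B` termwise (so `a0√2 ≤ 1`), `A ≥ 12/64` (first shell) and `B ≤ (2/3)·(T³ − 1)` with
`T = Σ_{m ∈ ℤ} (1+m²)⁻¹ ≤ 3.156` (product trick over the box, AM–GM), whence `(3/5)⁶ ≤ 8A/B = (a0√2)⁶`. -/

section Numerics

/-- `len_one_sq` (docstring added by the landing lane; see the module docstring). [formal bookkeeping] -/
theorem len_one_sq (n : D3) : len 1 n ^ 2 = nsq n.1 := by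
  rw [len, one_mul, Real.sq_sqrt (nsq_nonneg _)]

/-- `inv_len_pow_six` (docstring added by the landing lane; see the module docstring). [formal bookkeeping] -/
theorem inv_len_pow_six (n : D3) : (len 1 n)⁻¹ ^ 6 = ((nsq n.1)⁻¹) ^ 3 := by
  rw [← len_one_sq, inv_pow, inv_pow, ← pow_mul]

/-- `inv_len_pow_twelve` (docstring added by the landing lane; see the module docstring). [formal bookkeeping] -/
theorem inv_len_pow_twelve (n : D3) : (len 1 n)⁻¹ ^ 12 = ((nsq n.1)⁻¹) ^ 6 := by
  rw [← len_one_sq, inv_pow, inv_pow, ← pow_mul]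

/-- `8·A ≤ B` (termwise, from `q ≥ 2`). -/
theorem eight_mul_epsteinA_le : 8 * epsteinA ≤ epsteinB := by
  rw [epsteinA, epsteinB, ← tsum_mul_left]
  refine Summable.tsum_le_tsum (fun n => ?_) ((summable_inv_len_pow 1 one_pos (by norm_num)).mul_left 8)
    (summable_inv_len_pow 1 one_pos (by norm_num))
  rw [inv_len_pow_six, inv_len_pow_twelve]
  have hq := two_le_nsq n
  have hq0 : 0 < nsq n.1 := nsq_pos n
  have h8 : 8 ≤ nsq n.1 ^ 3 := by
    calc (8 : ℝ) = 2 ^ 3 := by norm_num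
      _ ≤ nsq n.1 ^ 3 := pow_le_pow_left₀ (by norm_num) hq 3
  have hx : 0 < ((nsq n.1)⁻¹) ^ 3 := by positivity
  have hle : 8 * ((nsq n.1)⁻¹) ^ 3 ≤ 1 := by
    rw [inv_pow, ← div_eq_mul_inv, div_le_one (by positivity)]; exact h8
  calc 8 * (nsq n.1)⁻¹ ^ 6 = (8 * ((nsq n.1)⁻¹) ^ 3) * ((nsq n.1)⁻¹) ^ 3 := by ring
    _ ≤ 1 * ((nsq n.1)⁻¹) ^ 3 := mul_le_mul_of_nonneg_right hle hx.le
    _ = ((nsq n.1)⁻¹) ^ 3 := one_mul _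

/-- ★ Upper window: the stress-free nearest-neighbour distance `a0·√2` is at most `1`. -/
theorem a0_sqrt2_le_one : a0 * Real.sqrt 2 ≤ 1 := by
  have h6 : (a0 * Real.sqrt 2) ^ 6 ≤ 1 := by
    rw [mul_pow, a0_pow_six, show Real.sqrt 2 ^ 6 = (Real.sqrt 2 ^ 2) ^ 3 by ring, sqrt2_sq,
      div_mul_eq_mul_div, div_le_one epsteinB_pos]
    have := eight_mul_epsteinA_le
    linarith
  exact (pow_le_one_iff_of_nonneg (mul_pos a0_pos sqrt2_pos).le (by norm_num)).1 h6

/-! ### The product trick: `B ≤ (2/3)(T³ − 1)` -/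

/-- The one-dimensional weight `(1 + m²)⁻¹`. -/
def w (m : ℤ) : ℝ := (1 + (m : ℝ) ^ 2)⁻¹

/-- `w_pos` (docstring added by the landing lane; see the module docstring). [formal bookkeeping] -/
theorem w_pos (m : ℤ) : 0 < w m := by unfold w; positivity

/-- `w_zero` (docstring added by the landing lane; see the module docstring). [formal bookkeeping] -/
theorem w_zero : w 0 = 1 := by simp [w]

/-- `w_neg` (docstring added by the landing lane; see the module docstring). [formal bookkeeping] -/
theorem w_neg (m : ℤ) : w (-m) = w m := by simp [w]

/-- The product weight on `ℤ³` (the box sum runs over all of `ℤ³ ∖ 0 ⊇ D₃ ∖ 0`). -/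
def g (x : Fin 3 → ℤ) : ℝ := ∏ k, w (x k)

/-- `g_pos` (docstring added by the landing lane; see the module docstring). [formal bookkeeping] -/
theorem g_pos (x : Fin 3 → ℤ) : 0 < g x := Finset.prod_pos fun _ _ => w_pos _

/-- `g_zero` (docstring added by the landing lane; see the module docstring). [formal bookkeeping] -/
theorem g_zero : g 0 = 1 := by simp [g, w_zero]

/-- AM–GM step: for `x, y, z ≥ 0` with `x + y + z ≥ 2`, `(1+x)(1+y)(1+z) ≤ (2/3)(x+y+z)³`. -/
theorem prod_le_two_thirds (x y z : ℝ) (hx : 0 ≤ x) (hy : 0 ≤ y) (hz : 0 ≤ z) (hs : 2 ≤ x + y + z) :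
    (1 + x) * (1 + y) * (1 + z) ≤ 2 / 3 * (x + y + z) ^ 3 := by
  have e2 : 3 * (x * y + y * z + z * x) ≤ (x + y + z) ^ 2 := by
    nlinarith [sq_nonneg (x - y), sq_nonneg (y - z), sq_nonneg (z - x)]
  have e3 : 3 * (x * y * z) ≤ (x * y + y * z + z * x) * (x + y + z) := by
    nlinarith [mul_nonneg (mul_nonneg hx hx) hy, mul_nonneg (mul_nonneg hx hx) hz, mul_nonneg (mul_nonneg hy hy) hx,
      mul_nonneg (mul_nonneg hy hy) hz, mul_nonneg (mul_nonneg hz hz) hx, mul_nonneg (mul_nonneg hz hz) hy]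
  have hs0 : 0 ≤ x + y + z := by linarith
  have e2s : (x * y + y * z + z * x) * (x + y + z) ≤ (x + y + z) ^ 2 / 3 * (x + y + z) :=
    mul_le_mul_of_nonneg_right (by linarith) hs0
  have hpoly : 1 + (x + y + z) + (x + y + z) ^ 2 / 3 + (x + y + z) ^ 3 / 9 ≤ 2 / 3 * (x + y + z) ^ 3 := by
    nlinarith [mul_nonneg (sub_nonneg.2 hs) (sq_nonneg (x + y + z)), mul_nonneg (sub_nonneg.2 hs) hs0, sub_nonneg.2 hs]
  calc (1 + x) * (1 + y) * (1 + z) = 1 + (x + y + z) + (x * y + y * z + z * x) + x * y * z := by ring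
    _ ≤ 1 + (x + y + z) + (x + y + z) ^ 2 / 3 + (x + y + z) ^ 3 / 9 := by nlinarith [e2, e3, e2s]
    _ ≤ _ := hpoly

/-- Termwise: `q⁻³ ≤ (2/3)·Π_k (1 + n_k²)⁻¹` on `D₃ ∖ 0`. -/
theorem inv_cube_le_g (n : D3) : ((nsq n.1)⁻¹) ^ 3 ≤ 2 / 3 * g n.1 := by
  have hq : nsq n.1 = ((n.1 0 : ℤ) : ℝ) ^ 2 + ((n.1 1 : ℤ) : ℝ) ^ 2 + ((n.1 2 : ℤ) : ℝ) ^ 2 := by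
    simp [nsq, Fin.sum_univ_three]
  have hprod := prod_le_two_thirds _ _ _ (sq_nonneg ((n.1 0 : ℤ) : ℝ)) (sq_nonneg ((n.1 1 : ℤ) : ℝ))
    (sq_nonneg ((n.1 2 : ℤ) : ℝ)) (by rw [← hq]; exact two_le_nsq n)
  rw [← hq] at hprod
  have hP : 0 < (1 + ((n.1 0 : ℤ) : ℝ) ^ 2) * (1 + ((n.1 1 : ℤ) : ℝ) ^ 2) * (1 + ((n.1 2 : ℤ) : ℝ) ^ 2) := by positivity
  have hg : g n.1 = ((1 + ((n.1 0 : ℤ) : ℝ) ^ 2) * (1 + ((n.1 1 : ℤ) : ℝ) ^ 2) * (1 + ((n.1 2 : ℤ) : ℝ) ^ 2))⁻¹ := by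
    rw [g, Fin.prod_univ_three, w, w, w, ← mul_inv, ← mul_inv]
  calc ((nsq n.1)⁻¹) ^ 3 = (nsq n.1 ^ 3)⁻¹ := inv_pow _ _
    _ ≤ (3 / 2 * ((1 + ((n.1 0 : ℤ) : ℝ) ^ 2) * (1 + ((n.1 1 : ℤ) : ℝ) ^ 2) * (1 + ((n.1 2 : ℤ) : ℝ) ^ 2)))⁻¹ :=
        inv_anti₀ (by positivity) (by linarith)
    _ = 2 / 3 * g n.1 := by rw [hg, mul_inv]; norm_num

/-- The box `[−M, M]³` and the one-dimensional box sum. -/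
def box (M : ℕ) : Finset (Fin 3 → ℤ) := Fintype.piFinset fun _ => Finset.Icc (-(M : ℤ)) M

/-- `T` (docstring added by the landing lane; see the module docstring). [formal bookkeeping] -/
def T (M : ℕ) : ℝ := ∑ m ∈ Finset.Icc (-(M : ℤ)) M, w m

/-- `sum_box_g` (docstring added by the landing lane; see the module docstring). [formal bookkeeping] -/
theorem sum_box_g (M : ℕ) : ∑ x ∈ box M, g x = T M ^ 3 := by
  rw [box]
  simp only [g]
  rw [← Finset.prod_univ_sum (fun _ : Fin 3 => Finset.Icc (-(M : ℤ)) M) (fun _ m => w m)]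
  simp [T, Finset.prod_const]

/-- `zero_mem_box` (docstring added by the landing lane; see the module docstring). [formal bookkeeping] -/
theorem zero_mem_box (M : ℕ) : (0 : Fin 3 → ℤ) ∈ box M :=
  Fintype.mem_piFinset.2 fun k => by simp

/-- The coordinate bound of a finite set of lattice vectors. -/
def Mof (s : Finset D3) : ℕ := s.sup fun n => Finset.univ.sup fun k => (n.1 k).natAbs

/-- `natAbs_le_Mof` (docstring added by the landing lane; see the module docstring). [formal bookkeeping] -/
theorem natAbs_le_Mof {s : Finset D3} {n : D3} (hn : n ∈ s) (k : Fin 3) : (n.1 k).natAbs ≤ Mof s :=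
  le_trans (Finset.le_sup (f := fun k => (n.1 k).natAbs) (Finset.mem_univ k))
    (Finset.le_sup (f := fun n : D3 => Finset.univ.sup fun k => (n.1 k).natAbs) hn)

/-- Partial sums of the product weight over `D₃ ∖ 0` are at most `T³ − 1`. -/
theorem sum_g_le (s : Finset D3) : ∑ n ∈ s, g n.1 ≤ T (Mof s) ^ 3 - 1 := by
  have hsub : s.map ⟨Subtype.val, Subtype.val_injective⟩ ⊆ (box (Mof s)).erase 0 := by
    intro x hx
    rw [Finset.mem_map] at hx
    obtain ⟨n, hn, rfl⟩ := hx
    rw [Finset.mem_erase]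
    refine ⟨n.2.1, Fintype.mem_piFinset.2 fun k => ?_⟩
    have := natAbs_le_Mof hn k
    rw [Finset.mem_Icc]
    simp only [Function.Embedding.coeFn_mk]
    omega
  calc ∑ n ∈ s, g n.1 = ∑ x ∈ s.map ⟨Subtype.val, Subtype.val_injective⟩, g x := by rw [Finset.sum_map]; rfl
    _ ≤ ∑ x ∈ (box (Mof s)).erase 0, g x := Finset.sum_le_sum_of_subset_of_nonneg hsub fun x _ _ => (g_pos x).le
    _ = T (Mof s) ^ 3 - 1 := by rw [Finset.sum_erase_eq_sub (zero_mem_box _), sum_box_g, g_zero]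

/-! ### The one-dimensional sum `T ≤ 3.156` -/

/-- `Icc_succ` (docstring added by the landing lane; see the module docstring). [formal bookkeeping] -/
theorem Icc_succ (M : ℕ) :
    Finset.Icc (-((M : ℤ) + 1)) ((M : ℤ) + 1) = insert ((M : ℤ) + 1) (insert (-((M : ℤ) + 1)) (Finset.Icc (-(M : ℤ)) M)) := by
  ext m
  simp only [Finset.mem_Icc, Finset.mem_insert]
  omega

/-- `T_zero` (docstring added by the landing lane; see the module docstring). [formal bookkeeping] -/
theorem T_zero : T 0 = 1 := by
  simp [T, w]

/-- `T_succ` (docstring added by the landing lane; see the module docstring). [formal bookkeeping] -/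
theorem T_succ (M : ℕ) : T (M + 1) = T M + 2 * w ((M : ℤ) + 1) := by
  rw [T, T, Nat.cast_succ, Icc_succ, Finset.sum_insert, Finset.sum_insert, w_neg]
  · ring
  · simp only [Finset.mem_Icc]; omega
  · simp only [Finset.mem_insert, Finset.mem_Icc]; omega

/-- The positive half-sum `U M = Σ_{k=1}^{M} (1+k²)⁻¹`. -/
def U (M : ℕ) : ℝ := ∑ k ∈ Finset.range M, w ((k : ℤ) + 1)

/-- `T_eq` (docstring added by the landing lane; see the module docstring). [formal bookkeeping] -/
theorem T_eq (M : ℕ) : T M = 1 + 2 * U M := by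
  induction M with
  | zero => simp [T_zero, U]
  | succ M ih => rw [T_succ, ih, U, U, Finset.sum_range_succ]; ring

/-- `U_twenty_le` (docstring added by the landing lane; see the module docstring). [formal bookkeeping] -/
theorem U_twenty_le : U 20 ≤ 1028 / 1000 := by
  unfold U w
  norm_num [Finset.sum_range_succ]

/-- `U_mono` (docstring added by the landing lane; see the module docstring). [formal bookkeeping] -/
theorem U_mono {M N : ℕ} (h : M ≤ N) : U M ≤ U N :=
  Finset.sum_le_sum_of_subset_of_nonneg (Finset.range_mono h) fun _ _ _ => (w_pos _).le

/-- `w_step` (docstring added by the landing lane; see the module docstring). [formal bookkeeping] -/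
theorem w_step (j : ℕ) : w (((20 + j : ℕ) : ℤ) + 1) ≤ 1 / (20 + (j : ℝ)) - 1 / (20 + ((j : ℝ) + 1)) := by
  unfold w
  push_cast
  rw [div_sub_div _ _ (by positivity) (by positivity), inv_eq_one_div,
    div_le_div_iff₀ (by positivity) (by positivity)]
  nlinarith

/-- `U_tail` (docstring added by the landing lane; see the module docstring). [formal bookkeeping] -/
theorem U_tail (j : ℕ) : U (20 + j) ≤ U 20 + 1 / 20 - 1 / (20 + (j : ℝ)) := by
  induction j with
  | zero => simp
  | succ j ih =>
    have hU : U (20 + (j + 1)) = U (20 + j) + w (((20 + j : ℕ) : ℤ) + 1) := by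
      rw [show 20 + (j + 1) = (20 + j) + 1 from rfl, U, Finset.sum_range_succ, U]
    rw [hU]
    have := w_step j
    push_cast at hU this ih ⊢
    linarith

/-- `U_le` (docstring added by the landing lane; see the module docstring). [formal bookkeeping] -/
theorem U_le (M : ℕ) : U M ≤ 1078 / 1000 := by
  rcases le_or_gt M 20 with h | h
  · exact (U_mono h).trans (by linarith [U_twenty_le])
  · obtain ⟨j, rfl⟩ : ∃ j, M = 20 + j := ⟨M - 20, by omega⟩
    have h1 := U_tail j
    have hj : (0 : ℝ) ≤ 1 / (20 + (j : ℝ)) := by positivity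
    linarith [U_twenty_le]

/-- `T_le` (docstring added by the landing lane; see the module docstring). [formal bookkeeping] -/
theorem T_le (M : ℕ) : T M ≤ 3156 / 1000 := by
  rw [T_eq]; have := U_le M; linarith

/-- `one_le_T` (docstring added by the landing lane; see the module docstring). [formal bookkeeping] -/
theorem one_le_T (M : ℕ) : 1 ≤ T M := by
  rw [T_eq]
  have : 0 ≤ U M := Finset.sum_nonneg fun _ _ => (w_pos _).le
  linarith

/-- ★ Partial sums of `Σ q⁻³` over `D₃ ∖ 0` are at most `(2/3)(3.156³ − 1) ≈ 20.3`. -/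
theorem sum_inv_len_six_le (s : Finset D3) : ∑ n ∈ s, (len 1 n)⁻¹ ^ 6 ≤ 2 / 3 * ((3156 / 1000 : ℝ) ^ 3 - 1) := by
  have hT := T_le (Mof s)
  have hT1 := one_le_T (Mof s)
  calc ∑ n ∈ s, (len 1 n)⁻¹ ^ 6 = ∑ n ∈ s, ((nsq n.1)⁻¹) ^ 3 := Finset.sum_congr rfl fun n _ => inv_len_pow_six n
    _ ≤ ∑ n ∈ s, 2 / 3 * g n.1 := Finset.sum_le_sum fun n _ => inv_cube_le_g n
    _ = 2 / 3 * ∑ n ∈ s, g n.1 := by rw [Finset.mul_sum]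
    _ ≤ 2 / 3 * (T (Mof s) ^ 3 - 1) := by have := sum_g_le s; linarith
    _ ≤ 2 / 3 * ((3156 / 1000 : ℝ) ^ 3 - 1) := by
        have : T (Mof s) ^ 3 ≤ (3156 / 1000 : ℝ) ^ 3 := pow_le_pow_left₀ (by linarith) hT 3
        linarith

/-- ★ `B ≤ 20.3`. -/
theorem epsteinB_le : epsteinB ≤ 2 / 3 * ((3156 / 1000 : ℝ) ^ 3 - 1) :=
  Real.tsum_le_of_sum_le (fun n => pow_nonneg (inv_nonneg.2 (len_pos 1 one_pos n).le) _) sum_inv_len_six_le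

/-! ### The first shell: `A ≥ 12/64` -/

/-- The twelve nearest neighbours `(±1, ±1, 0)` and permutations. -/
def nnTab : Fin 12 → Fin 3 → ℤ :=
  ![![1, 1, 0], ![1, -1, 0], ![-1, 1, 0], ![-1, -1, 0], ![1, 0, 1], ![1, 0, -1], ![-1, 0, 1], ![-1, 0, -1],
    ![0, 1, 1], ![0, 1, -1], ![0, -1, 1], ![0, -1, -1]]

/-- `nsq_nnTab` (docstring added by the landing lane; see the module docstring). [formal bookkeeping] -/
theorem nsq_nnTab (i : Fin 12) : nsq (nnTab i) = 2 := by
  fin_cases i <;> simp [nnTab, nsq, Fin.sum_univ_three] <;> norm_num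

/-- `even_nnTab` (docstring added by the landing lane; see the module docstring). [formal bookkeeping] -/
theorem even_nnTab (i : Fin 12) : Even (∑ k, nnTab i k) := by
  fin_cases i <;> simp [nnTab, Fin.sum_univ_three]

/-- `nnTab_ne_zero` (docstring added by the landing lane; see the module docstring). [formal bookkeeping] -/
theorem nnTab_ne_zero (i : Fin 12) : nnTab i ≠ 0 := fun h => by
  have := nsq_nnTab i
  rw [h] at this
  simp [nsq] at this

/-- The twelve nearest neighbours as elements of `D₃ ∖ 0`. -/
def nnD3 (i : Fin 12) : D3 := ⟨nnTab i, nnTab_ne_zero i, even_nnTab i⟩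

/-- `nnTab_injective` (docstring added by the landing lane; see the module docstring). [formal bookkeeping] -/
theorem nnTab_injective : Function.Injective nnTab := by
  unfold Function.Injective
  decide

/-- `nnD3_injective` (docstring added by the landing lane; see the module docstring). [formal bookkeeping] -/
theorem nnD3_injective : Function.Injective nnD3 := fun _ _ h =>
  nnTab_injective (congrArg Subtype.val h)

/-- ★ `A ≥ 12/64 = 3/16`. -/
theorem epsteinA_ge : 3 / 16 ≤ epsteinA := by
  have hs := (summable_inv_len_pow 1 one_pos (by norm_num : 3 < 12)).sum_le_tsum
    (Finset.univ.map ⟨nnD3, nnD3_injective⟩) (fun n _ => pow_nonneg (inv_nonneg.2 (len_pos 1 one_pos n).le) _)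
  rw [Finset.sum_map] at hs
  have hterm : ∀ i, (len 1 (nnD3 i))⁻¹ ^ 12 = 1 / 64 := fun i => by
    rw [inv_len_pow_twelve]
    show ((nsq (nnTab i))⁻¹) ^ 6 = 1 / 64
    rw [nsq_nnTab]; norm_num
  simp only [Function.Embedding.coeFn_mk, hterm, Finset.sum_const, Finset.card_univ, Fintype.card_fin, nsmul_eq_mul] at hs
  rw [epsteinA]
  norm_num at hs ⊢
  linarith

/-- ★ Lower window: the stress-free nearest-neighbour distance `a0·√2` is at least `3/5`. -/
theorem three_fifths_le_a0_sqrt2 : 3 / 5 ≤ a0 * Real.sqrt 2 := by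
  have h6 : (3 / 5 : ℝ) ^ 6 ≤ (a0 * Real.sqrt 2) ^ 6 := by
    rw [mul_pow, a0_pow_six, show Real.sqrt 2 ^ 6 = (Real.sqrt 2 ^ 2) ^ 3 by ring, sqrt2_sq,
      div_mul_eq_mul_div, le_div_iff₀ epsteinB_pos]
    have hA := epsteinA_ge
    have hB := epsteinB_le
    have hB0 := epsteinB_pos
    nlinarith
  exact (pow_le_pow_iff_left₀ (by norm_num) (mul_pos a0_pos sqrt2_pos).le (by norm_num)).1 h6

/-- The labelling scale `t = a0 / b'` with `b' = bOf (9/10)` lies in `[2/3, 10/9]`. -/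
theorem fcc_window : |a0 / bOf (9 / 10) - 1| ≤ 1 / 3 ∧ 1 / 2 ≤ a0 / bOf (9 / 10) := by
  have ht : a0 / bOf (9 / 10) = a0 * Real.sqrt 2 * (10 / 9) := by
    rw [div_eq_iff (bOf_pos (by norm_num : (0 : ℝ) < 9 / 10)).ne', bOf]
    linear_combination (-(a0 / 2)) * sqrt2_sq
  rw [ht]
  have h1 := a0_sqrt2_le_one
  have h2 := three_fifths_le_a0_sqrt2
  refine ⟨abs_le.2 ⟨by linarith, by linarith⟩, by linarith⟩

end Numerics

/-! ## ★★★ THE FCC WITNESS: the (H𝄪) hypothesis block minus stability, at the record dials -/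

/-- ★★★ The stress-free fcc reference configuration `a0·D₃` (cubic coordinates, one-point motif) satisfies the WHOLE
admissibility block of `(H𝄪)` except harmonic stability, AT THE RECORD DIALS: it is `3/5`-separated, `(1/3, 3)`-labelled
(by the Barlow image `fcc` at spacing `9/10` through a homothety), force-free and stress-free. -/
theorem fcc_witness :
    IsSeparatedRef (3 / 5) (fccRef a0 a0_pos) ∧ IsLabelledRef (1 / 3) 3 (fccRef a0 a0_pos) ∧
      IsForceFree (fccRef a0 a0_pos) ∧ IsStressFree (fccRef a0 a0_pos) := by
  refine ⟨fun y hy z hz hyz => le_trans three_fifths_le_a0_sqrt2 (fcc_separated a0 a0_pos y hy z hz hyz), ?_,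
    isForceFree_fcc a0 a0_pos, isStressFree_fcc a0 a0_pos S_a0_eq_zero⟩
  have h910 : (9 : ℝ) / 10 ≤ 9 / 10 ∧ (9 : ℝ) / 10 ≤ 11 / 10 := ⟨le_rfl, by norm_num⟩
  obtain ⟨hw1, hw2⟩ := fcc_window
  exact fcc_labelled a0_pos (bOf_pos (by norm_num)) (isBarlowImage_fcc h910) hw1 hw2

/-- `exists_admissible_minus_stab` (docstring added by the landing lane; see the module docstring). [formal bookkeeping] -/
theorem exists_admissible_minus_stab : ∃ P : PeriodicConfiguration 3,
    IsSeparatedRef (3 / 5) P ∧ IsLabelledRef (1 / 3) 3 P ∧ IsForceFree P ∧ IsStressFree P :=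
  ⟨_, fcc_witness⟩

/-! ## ★★★ The alarm on the admissible reference -/

section Alarm

/-- The short bond `(0, a₀(1,1,0))` of length `a₀√2 ≤ 1 ≤ 2` at the motif point. -/
theorem fcc_short_bond : ∃ y ∈ (fccRef a0 a0_pos).motif, ∃ z ∈ (fccRef a0 a0_pos).points, z ≠ y ∧ dist y z ≤ 2 := by
  refine ⟨0, by simp [fccRef_motif], vec a0 e0.1, vec_mem_points a0_pos e0.2.2,
    fun h => e0.2.1 ((vec_eq_zero_iff a0 a0_pos e0.1).1 h), ?_⟩
  rw [dist_zero_vec a0 a0_pos, nsq_e0]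
  linarith [a0_sqrt2_le_one]

/-- ★★★ The alarm of P-I(1/2) on the ADMISSIBLE reference: `HarmStableWith μ₀ (fccRef a₀)` fails for every `μ₀ > 0`. -/
theorem fccRef_not_harmStableWith {μ₀ : ℝ} (hμ : 0 < μ₀) : ¬ HarmStableWith μ₀ (fccRef a0 a0_pos) :=
  not_harmStableWith hμ (isStressFree_fcc a0 a0_pos S_a0_eq_zero) fcc_short_bond

/-- ★★★ **(V2) ON AN ADMISSIBLE REFERENCE.**  The whole hypothesis block of the generation-53–56 piece (H𝄪) EXCEPT `HarmStableWith` —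
`IsSeparatedRef (3/5) ∧ IsLabelledRef (1/3) 3 ∧ IsForceFree ∧ IsStressFree` at the record dials — is SATISFIABLE, by a reference on which
`HarmStableWith μ₀` FAILS for every `μ₀ > 0`. -/
theorem exists_admissible_not_harmStableWith : ∃ P : PeriodicConfiguration 3,
    IsSeparatedRef (3 / 5) P ∧ IsLabelledRef (1 / 3) 3 P ∧ IsForceFree P ∧ IsStressFree P ∧
      ∀ μ₀ : ℝ, 0 < μ₀ → ¬ HarmStableWith μ₀ P :=
  ⟨fccRef a0 a0_pos, fcc_witness.1, fcc_witness.2.1, fcc_witness.2.2.1, fcc_witness.2.2.2, fun _ hμ => fccRef_not_harmStableWith hμ⟩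

/-- … in particular the record stability margin `μ₀ = 1/100` of (H𝄪) is violated on the admissible fcc reference. -/
theorem fccRef_not_harmStableWith_record : ¬ HarmStableWith (1 / 100) (fccRef a0 a0_pos) :=
  fccRef_not_harmStableWith (by norm_num)

end Alarm

end Fcc

end Summit.AtomisticToContinuum.Crystallization.Theorems.ChargedEnergyGapChartDial

end
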